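import Mathlib
import Summits.CriticalPhenomena.PercolationContinuityZ3.Theorems.PinholeClosing.Negative.PinholeClosingBaseline
import Summits.CriticalPhenomena.PercolationContinuityZ3.Theorems.PercBudgetLadderPinholeClosingStubTightPocketExists
import Literature.Probability.Percolation.MinOpenCut
import Literature.Probability.Percolation.SequentialProbing
import HarnessLib

/-!
# Crux `PercBudgetLadder.PinholeClosing` (stmt-CriticalPhenomena-5249), line `pocket-resampling` — stub `stub_tightPocketExists`

Helper file for the crux skeleton `Cruxes/PinholeClosing/Lines/pocket_resampling.lean`
(lead prover-line-stmt-CriticalPhenomena-5249-c1-0); proves exactly the registered stub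
`stub_tightPocketExists` of that skeleton (`--supports stmt-CriticalPhenomena-5249`).  No new definitions:
the statement is in the tree's vocabulary (`box`, `innerBoundary`, `openConnIn`, `obs`, `edgeBoundary`).

NAME.  The flat name `Summit.CriticalPhenomena.PercolationContinuityZ3.Theorems.stub_tightPocketExists` is
already taken by the tree file `Theorems/PercBudgetLadderPinholeClosingStubTightPocketExists.lean` (the same
stub of the EARLIER skeleton `Lines/pocket_resampling_liveness_mass.lean`, stated with
`(edgeBoundary (zdGraph 3) A).filter (· ∈ ω)` and a bare `∃ A`), so the present registered signature (doors
written `obs ω (edgeBoundary (zdGraph 3) A)`, conclusion `∃ A ∈ (box 3 m).powerset, …`) is landed one namespace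
down, as `Summit.CriticalPhenomena.PercolationContinuityZ3.Theorems.PocketResampling.stub_tightPocketExists`
(from the skeleton: `Theorems.PocketResampling.stub_tightPocketExists`).

Informal statement.  Window `(n, m)`, `n < m`, of bond percolation on `ℤ³`; a vertex set `A` is ADMISSIBLE if
`box 3 n ⊆ A ⊆ box 3 m ∖ ∂ⁱⁿ box 3 m`, its DOORS are its `ω`-open boundary edges
`obs ω (edgeBoundary (zdGraph 3) A)`.  If closing some `≤ k+1` edges `S` leaves no `ω`-open path inside `box 3 m`
from `box 3 n` to `∂ⁱⁿ box 3 m`, then there is a TIGHT `k`-POCKET `A ⊆ box 3 m`: admissible, `≤ k+1` doors, and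
every admissible proper subset of `A` has `≥ k+2` doors.

Proof route.  This is the tree theorem `Theorems.stub_tightPocketExists` (the source cluster of `box 3 n` in
`ω ∖ S` inside `box 3 m` is admissible with all open boundary edges in `S`; a cardinality-minimal admissible set
with `≤ k+1` open boundary edges is `⊂`-minimal), transported along `obs ω D = D.filter (· ∈ ω)` (definitional,
`Literature/Probability/Percolation/SequentialProbing.lean`), plus `A ⊆ box 3 m ∖ ∂ⁱⁿ box 3 m ⊆ box 3 m` for the
powerset membership.
-/

noncomputable section

namespace Summit.CriticalPhenomena.PercolationContinuityZ3.Theorems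

open MeasureTheory Finset
open Literature.Probability.Percolation Literature.Probability.LatticeModels
open Summit.CriticalPhenomena.PercolationContinuityZ3.Theorems.PinholeClosing.Negative

namespace PocketResampling

/-- **Existence of a tight pocket on the budget-`(k+1)` event** (line `pocket-resampling`, registered stub
`stub_tightPocketExists`, VERBATIM signature).  For a lattice configuration `ω` such that closing some `≤ k+1`
edges leaves no open path inside `box 3 m` from `box 3 n` to `∂ⁱⁿ box 3 m` (`n < m`), there is
`A ⊆ box 3 m` with `box 3 n ⊆ A ⊆ box 3 m ∖ ∂ⁱⁿ box 3 m`, at most `k+1` open boundary edges, and such that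
every admissible proper subset of `A` has at least `k+2` open boundary edges. -/
theorem stub_tightPocketExists :
    ∀ (k n m : ℕ) (ω : BondConfig (Site 3)), n < m → ω ⊆ (zdGraph 3).edgeSet →
      ω ∈ {ω : BondConfig (Site 3) | ∃ S : Finset (Sym2 (Site 3)), S.card ≤ k + 1 ∧ ¬ ∃ x ∈ box 3 n,
        ∃ y ∈ innerBoundary (zdGraph 3) (box 3 m), (ω \ (↑S : Set (Sym2 (Site 3)))) ∈ openConnIn (↑(box 3 m) : Set (Site 3)) x y} →
      ∃ A ∈ (box 3 m).powerset,
        (box 3 n ⊆ A ∧ A ⊆ box 3 m \ innerBoundary (zdGraph 3) (box 3 m)) ∧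
        (obs ω (edgeBoundary (zdGraph 3) A)).card ≤ k + 1 ∧
        ∀ A' : Finset (Site 3), (box 3 n ⊆ A' ∧ A' ⊆ box 3 m \ innerBoundary (zdGraph 3) (box 3 m)) →
          A' ⊂ A → k + 2 ≤ (obs ω (edgeBoundary (zdGraph 3) A')).card := by
  intro k n m ω hnm hω hmem
  obtain ⟨A, hAadm, hAk, hmin⟩ :=
    _root_.Summit.CriticalPhenomena.PercolationContinuityZ3.Theorems.stub_tightPocketExists k n m ω hnm hω hmem
  exact ⟨A, Finset.mem_powerset.2 (hAadm.2.trans Finset.sdiff_subset), hAadm, hAk, hmin⟩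

end PocketResampling

end Summit.CriticalPhenomena.PercolationContinuityZ3.Theorems

end
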